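import Mathlib
import HarnessLib

/-!
# The deck-transformation conjugation in the theta quotient: normal-form bookkeeping behind the
# `Z`-action clause of [EtTh] Prop. 1.5 (iii)

Mochizuki, *The étale theta function …*, Publ. RIMS **45** (2009), Prop. 1.5 (iii), PRIMS PDF p. 23
[cite: MochizukiEtTh2009, Prop 1.5 (iii) p.23]: a lift `σ` of `a ∈ Z ≅ Π^tp_X/Π^tp_Y` acts on the lifted
theta class by "`η̈^Θ ↦ η̈^Θ − 2a·log(Ü) − (a²/2)·log(q_X) + log(O^×_K̈)`".

PROOF-ONLY, pure group theory (seat abc-iut-L2-t12, gen 4; kernel cross-check of the STAGE-2 SPEC posted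
to the R78 model cluster, STATUS 2026-08-26T06:59:06Z). In ANY group with elements `a` (deck generator),
`b` (the `Ẑ(1)`-direction), `c` (the generator of `Δ_Θ`, `c = ⁅a,b⁆` in the application) and `g`
(a Galois element) subject only to
`b c = c b`, `a c = c a`, `a⁻¹ b a = c⁻¹ b` and the TWISTED relation `a⁻¹ g a = b^k c^m g` (`k, m ∈ ℤ`;
in the genuine situation `k`, `m` are the values at `g` of the Kummer cocycles of `q_X` and of `q̈⁻¹`
up to units — Tate's extension class), one has for every `n : ℕ`

  `(aⁿ)⁻¹ (b^β c^γ g) aⁿ = b^(β + n k) c^(γ − n β − (n(n−1)/2) k + n m) g`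

(`conj_pow_normalForm`). Reading the `c`-exponent as the `Δ_Θ`-coordinate cocycle (the lifted theta
class) and `β/2` as `log(Ü)`: the split model (`k = m = 0`) gives `γ − nβ` — NO `log(q̈)` term — while
`k = 2κ`, `m = −κ` gives `γ − nβ − n²κ` (`conj_pow_normalForm_tate`), i.e. print's
`− 2n·log(Ü) − n²·log(q̈)`. HONEST FRAMING: elementary identities; nothing of [EtTh] is asserted; no side
taken on [IUTchIII] Cor. 3.12; a model is consistency evidence only.
-/

namespace Literature.AnabelianGeometry.EtaleTheta

namespace ThetaDeckConjugation

variable {P : Type*} [Group P] {a b c g : P}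

/-- `a⁻¹ bᵝ a = c^{-β} bᵝ` from `a⁻¹ b a = c⁻¹ b` and `b c = c b`. [cite: MochizukiEtTh2009, Prop 1.5 (iii) p.23] -/
theorem conj_zpow_b (hbc : b * c = c * b) (hab : a⁻¹ * b * a = c⁻¹ * b) (β : ℤ) :
    a⁻¹ * b ^ β * a = c ^ (-β) * b ^ β := by
  have h1 : a⁻¹ * b ^ β * a = (a⁻¹ * b * a) ^ β := by
    rw [← MulAut.conj_inv_apply, map_zpow, MulAut.conj_inv_apply]
  have hcb : Commute c⁻¹ b := by
    rw [Commute, SemiconjBy, inv_mul_eq_iff_eq_mul, ← mul_assoc, ← hbc, mul_inv_cancel_right]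
  rw [h1, hab, hcb.mul_zpow, inv_zpow']

/-- `a⁻¹ cᵞ a = cᵞ` from `a c = c a`. [cite: MochizukiEtTh2009, Prop 1.5 (iii) p.23] -/
theorem conj_zpow_c (hac : a * c = c * a) (γ : ℤ) : a⁻¹ * c ^ γ * a = c ^ γ := by
  have hc : a⁻¹ * c * a = c := by
    rw [mul_assoc, inv_mul_eq_iff_eq_mul, hac]
  rw [← MulAut.conj_inv_apply, map_zpow, MulAut.conj_inv_apply, hc]

/-- **One deck step.** With `b c = c b`, `a c = c a`, `a⁻¹ b a = c⁻¹ b` and the twisted Galois relation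
`a⁻¹ g a = b^k c^m g`: `a⁻¹ (b^β c^γ g) a = b^(β + k) c^(γ − β + m) g`.
[cite: MochizukiEtTh2009, Prop 1.5 (iii) p.23] -/
theorem conj_normalForm_step (hbc : b * c = c * b) (hac : a * c = c * a) (hab : a⁻¹ * b * a = c⁻¹ * b)
    {k m : ℤ} (hag : a⁻¹ * g * a = b ^ k * c ^ m * g) (β γ : ℤ) :
    a⁻¹ * (b ^ β * c ^ γ * g) * a = b ^ (β + k) * c ^ (γ - β + m) * g := by
  have hbc' : Commute b c := hbc
  have e1 : a⁻¹ * (b ^ β * c ^ γ * g) * a =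
      (a⁻¹ * b ^ β * a) * (a⁻¹ * c ^ γ * a) * (a⁻¹ * g * a) := by group
  rw [e1, conj_zpow_b hbc hab, conj_zpow_c hac, hag]
  -- reorder the commuting `b`- and `c`-powers
  have e2 : c ^ (-β) * b ^ β * c ^ γ * (b ^ k * c ^ m * g) =
      b ^ β * b ^ k * (c ^ (-β) * c ^ γ * c ^ m) * g := by
    have h1 : c ^ (-β) * b ^ β = b ^ β * c ^ (-β) := ((hbc'.symm.zpow_zpow (-β) β)).eq
    have h2 : c ^ γ * b ^ k = b ^ k * c ^ γ := ((hbc'.symm.zpow_zpow γ k)).eq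
    have h3 : c ^ (-β) * b ^ k = b ^ k * c ^ (-β) := ((hbc'.symm.zpow_zpow (-β) k)).eq
    calc c ^ (-β) * b ^ β * c ^ γ * (b ^ k * c ^ m * g)
        = b ^ β * c ^ (-β) * (c ^ γ * b ^ k) * c ^ m * g := by rw [h1]; group
      _ = b ^ β * (c ^ (-β) * b ^ k) * c ^ γ * c ^ m * g := by rw [h2]; group
      _ = b ^ β * b ^ k * (c ^ (-β) * c ^ γ * c ^ m) * g := by rw [h3]; group
  rw [e2, ← zpow_add, ← zpow_add, ← zpow_add]
  congr 2
  ring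

/-- **`n` deck steps (closed form).** Under the same relations, for every `n : ℕ`:
`(aⁿ)⁻¹ (b^β c^γ g) aⁿ = b^(β + n k) c^(γ − n β − (n(n−1)/2) k + n m) g` — the `c`-exponent is
QUADRATIC in `n` with leading coefficient `−k/2`, linear part `m + k/2 − β`.
[cite: MochizukiEtTh2009, Prop 1.5 (iii) p.23] -/
theorem conj_pow_normalForm (hbc : b * c = c * b) (hac : a * c = c * a) (hab : a⁻¹ * b * a = c⁻¹ * b)
    {k m : ℤ} (hag : a⁻¹ * g * a = b ^ k * c ^ m * g) (β γ : ℤ) (n : ℕ) :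
    (a ^ n)⁻¹ * (b ^ β * c ^ γ * g) * a ^ n =
      b ^ (β + n * k) * c ^ (γ - n * β - ((n : ℤ) * (n - 1) / 2) * k + n * m) * g := by
  induction n with
  | zero => simp
  | succ n ih =>
    have e1 : (a ^ (n + 1))⁻¹ * (b ^ β * c ^ γ * g) * a ^ (n + 1) =
        a⁻¹ * ((a ^ n)⁻¹ * (b ^ β * c ^ γ * g) * a ^ n) * a := by
      rw [pow_succ, mul_inv_rev]; group
    rw [e1, ih, conj_normalForm_step hbc hac hab hag]
    have htri : ((n + 1 : ℕ) : ℤ) * ((n + 1 : ℕ) - 1) / 2 = (n : ℤ) * (n - 1) / 2 + n := by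
      have h2 : ((n + 1 : ℕ) : ℤ) * ((n + 1 : ℕ) - 1) = (n : ℤ) * (n - 1) + n * 2 := by
        push_cast; ring
      rw [h2, Int.add_mul_ediv_right _ _ two_ne_zero]
    congr 2
    · push_cast; ring
    · rw [htri]; push_cast; ring

/-- **The Tate normalisation.** With `k = 2κ` and `m = −κ` (the Kummer cocycle of `q_X = q̈²` on the
`b`-axis, of `q̈⁻¹` on the `c`-axis) the `c`-exponent after `n` deck steps is `γ − nβ − n²κ` — print's
"`− 2a·log(Ü) − (a²/2)·log(q_X)`" with `a = n`, `log(Ü) = β/2`, `log(q̈) = κ`; with `k = m = 0` (a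
split model) it is `γ − nβ`, with no `log(q̈)` term. [cite: MochizukiEtTh2009, Prop 1.5 (iii) p.23] -/
theorem conj_pow_normalForm_tate (hbc : b * c = c * b) (hac : a * c = c * a)
    (hab : a⁻¹ * b * a = c⁻¹ * b) {κ : ℤ} (hag : a⁻¹ * g * a = b ^ (2 * κ) * c ^ (-κ) * g)
    (β γ : ℤ) (n : ℕ) :
    (a ^ n)⁻¹ * (b ^ β * c ^ γ * g) * a ^ n =
      b ^ (β + 2 * n * κ) * c ^ (γ - n * β - (n : ℤ) ^ 2 * κ) * g := by
  rw [conj_pow_normalForm hbc hac hab hag β γ n]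
  have heven : ((n : ℤ) * (n - 1) / 2) * 2 = (n : ℤ) * (n - 1) :=
    Int.ediv_mul_cancel (Int.even_mul_pred_self (n : ℤ)).two_dvd
  congr 2
  · ring
  · have : ((n : ℤ) * (n - 1) / 2) * (2 * κ) = (n : ℤ) * (n - 1) * κ := by
      rw [← mul_assoc, heven]
    rw [this]
    ring

/-- The split case `k = m = 0` (the deck generator commutes with the Galois element): the `c`-exponent
is `γ − nβ` exactly — no quadratic term. [cite: MochizukiEtTh2009, Prop 1.5 (iii) p.23] -/
theorem conj_pow_normalForm_split (hbc : b * c = c * b) (hac : a * c = c * a)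
    (hab : a⁻¹ * b * a = c⁻¹ * b) (hag : a⁻¹ * g * a = g) (β γ : ℤ) (n : ℕ) :
    (a ^ n)⁻¹ * (b ^ β * c ^ γ * g) * a ^ n = b ^ β * c ^ (γ - n * β) * g := by
  have hag' : a⁻¹ * g * a = b ^ (0 : ℤ) * c ^ (0 : ℤ) * g := by rw [zpow_zero, zpow_zero, one_mul, one_mul, hag]
  rw [conj_pow_normalForm hbc hac hab hag' β γ n]
  congr 2
  · ring
  · ring

end ThetaDeckConjugation

end Literature.AnabelianGeometry.EtaleTheta

/-! ### v2 (gen 4): all integer powers of the deck generator (`toZ σ ∈ ℤ`) -/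

namespace Literature.AnabelianGeometry.EtaleTheta

namespace ThetaDeckConjugation

variable {P : Type*} [Group P] {a b c g : P}

/-- `a b a⁻¹ = c b` (from `a⁻¹ b a = c⁻¹ b` and `a c = c a`). [cite: MochizukiEtTh2009, Prop 1.5 (iii) p.23] -/
theorem conj_b_inv (hac : a * c = c * a) (hab : a⁻¹ * b * a = c⁻¹ * b) : a * b * a⁻¹ = c * b := by
  have hc : a * c⁻¹ * a⁻¹ = c⁻¹ := by
    have h1 : a * c⁻¹ = c⁻¹ * a := by
      rw [mul_inv_eq_iff_eq_mul, mul_assoc, hac, inv_mul_cancel_left]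
    rw [h1, mul_inv_cancel_right]
  have key : b = c⁻¹ * (a * b * a⁻¹) := by
    calc b = a * (a⁻¹ * b * a) * a⁻¹ := by group
      _ = a * (c⁻¹ * b) * a⁻¹ := by rw [hab]
      _ = (a * c⁻¹ * a⁻¹) * (a * b * a⁻¹) := by group
      _ = c⁻¹ * (a * b * a⁻¹) := by rw [hc]
  rw [eq_inv_mul_iff_mul_eq] at key
  exact key.symm

/-- The relations for the INVERSE deck generator `a′ := a⁻¹`, `c′ := c⁻¹`: `a′⁻¹ b a′ = c′⁻¹ b`.
[cite: MochizukiEtTh2009, Prop 1.5 (iii) p.23] -/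
theorem conj_b_inv' (hac : a * c = c * a) (hab : a⁻¹ * b * a = c⁻¹ * b) :
    a⁻¹⁻¹ * b * a⁻¹ = c⁻¹⁻¹ * b := by
  rw [inv_inv, inv_inv]
  exact conj_b_inv hac hab

/-- The twisted Galois relation for the inverse deck generator: from `a⁻¹ g a = b^k c^m g` one gets
`a g a⁻¹ = b^(−k) c^(−k−m) g`, i.e. `(k′, m′) = (−k, k + m)` w.r.t. `c′ = c⁻¹`.
[cite: MochizukiEtTh2009, Prop 1.5 (iii) p.23] -/
theorem conj_g_inv (hbc : b * c = c * b) (hac : a * c = c * a) (hab : a⁻¹ * b * a = c⁻¹ * b)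
    {k m : ℤ} (hag : a⁻¹ * g * a = b ^ k * c ^ m * g) :
    a⁻¹⁻¹ * g * a⁻¹ = b ^ (-k) * c⁻¹ ^ (k + m) * g := by
  rw [inv_inv]
  have hb : a * b ^ k * a⁻¹ = (c * b) ^ k := by
    rw [← MulAut.conj_apply, map_zpow, MulAut.conj_apply, conj_b_inv hac hab]
  have hc : a * c ^ m * a⁻¹ = c ^ m := by
    have h1 : a * c * a⁻¹ = c := by rw [mul_inv_eq_iff_eq_mul, hac]
    rw [← MulAut.conj_apply, map_zpow, MulAut.conj_apply, h1]
  have hcb : Commute c b := (show Commute b c from hbc).symm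
  have key : g = (c * b) ^ k * c ^ m * (a * g * a⁻¹) := by
    calc g = a * (a⁻¹ * g * a) * a⁻¹ := by group
      _ = a * (b ^ k * c ^ m * g) * a⁻¹ := by rw [hag]
      _ = (a * b ^ k * a⁻¹) * (a * c ^ m * a⁻¹) * (a * g * a⁻¹) := by group
      _ = (c * b) ^ k * c ^ m * (a * g * a⁻¹) := by rw [hb, hc]
  have key2 : a * g * a⁻¹ = ((c * b) ^ k * c ^ m)⁻¹ * g := by
    rw [eq_inv_mul_iff_mul_eq]
    exact key.symm
  rw [key2, hcb.mul_zpow, mul_inv_rev, mul_inv_rev, ← zpow_neg, ← zpow_neg, ← zpow_neg, inv_zpow',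
    neg_add]
  have e1 : c ^ (-m) * b ^ (-k) = b ^ (-k) * c ^ (-m) := (hcb.zpow_zpow _ _).eq
  calc c ^ (-m) * (b ^ (-k) * c ^ (-k)) * g = (c ^ (-m) * b ^ (-k)) * c ^ (-k) * g := by group
    _ = b ^ (-k) * c ^ (-m) * c ^ (-k) * g := by rw [e1]
    _ = b ^ (-k) * (c ^ (-m) * c ^ (-k)) * g := by group
    _ = b ^ (-k) * c ^ (-k + -m) * g := by rw [← zpow_add, add_comm]

/-- **All integer powers, Tate normalisation.** With `k = 2κ`, `m = −κ`:
`(a^N)⁻¹ (b^β c^γ g) a^N = b^(β + 2Nκ) c^(γ − Nβ − N²κ) g` for every `N : ℤ` — the `Z`-action clause of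
Prop. 1.5 (iii) for lifts `σ` with `toZ σ = N` of either sign. [cite: MochizukiEtTh2009, Prop 1.5 (iii) p.23] -/
theorem conj_zpow_normalForm_tate (hbc : b * c = c * b) (hac : a * c = c * a)
    (hab : a⁻¹ * b * a = c⁻¹ * b) {κ : ℤ} (hag : a⁻¹ * g * a = b ^ (2 * κ) * c ^ (-κ) * g)
    (β γ : ℤ) (N : ℤ) :
    (a ^ N)⁻¹ * (b ^ β * c ^ γ * g) * a ^ N =
      b ^ (β + 2 * N * κ) * c ^ (γ - N * β - N ^ 2 * κ) * g := by
  obtain ⟨n, rfl | rfl⟩ := N.eq_nat_or_neg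
  · rw [zpow_natCast]
    exact conj_pow_normalForm_tate hbc hac hab hag β γ n
  · -- negative powers: apply the ℕ-statement to `a⁻¹`, `c⁻¹`
    have hbc' : b * c⁻¹ = c⁻¹ * b := by
      rw [mul_inv_eq_iff_eq_mul, mul_assoc, hbc, inv_mul_cancel_left]
    have hac' : a⁻¹ * c⁻¹ = c⁻¹ * a⁻¹ := by
      rw [← mul_inv_rev, ← mul_inv_rev, hac]
    have hab' := conj_b_inv' hac hab
    have hag' : a⁻¹⁻¹ * g * a⁻¹ = b ^ (2 * (-κ)) * c⁻¹ ^ (-(-κ)) * g := by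
      rw [conj_g_inv hbc hac hab hag]
      congr 2
      · congr 1; ring
      · congr 1; ring
    have h := conj_pow_normalForm_tate hbc' hac' hab' hag' β (-γ) n
    simp only [inv_zpow', neg_neg] at h
    rw [zpow_neg, zpow_natCast, ← inv_pow, h]
    congr 2
    · congr 1; ring
    · congr 1; ring

end ThetaDeckConjugation

end Literature.AnabelianGeometry.EtaleTheta
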